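import Summits.RiemannHypothesis.RiemannHypothesis.Theses.IntegerScrew
import Summits.RiemannHypothesis.RiemannHypothesis.Theorems.IntegerScrewScrewPolyFloorSplit

/-!
# IntegerScrew route — the assembly item

`Assembly := ScrewPolyFloor → DiscreteLandau → Summit.RiemannHypothesis` is verbatim the type of the
route's certified deciding theorem `Theses.IntegerScrew.closes` (indicator-vector diagonal extraction of
the polynomial floor gives `Ψ(log m) ≥ 0` for every integer `m ≥ 2`, `Ψ(0) = 0` handles `m = 1`, and
`DiscreteLandau` turns non-negativity of Suzuki's screw function at the logarithms of the integers into
Mathlib's `RiemannHypothesis`). This file lands the item by that theorem.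
-/

-- `Summit.RiemannHypothesis.RiemannHypothesis.…` duplicates `RiemannHypothesis` BY DESIGN (D-0017).
set_option linter.dupNamespace false

namespace Summit.RiemannHypothesis.RiemannHypothesis.Theorems

/-- The IntegerScrew assembly: a polynomial floor for Suzuki's integer screw matrices together with the
discrete Landau detection lemma implies the Riemann Hypothesis (summit statement). Proof: the route's
deciding theorem `Theses.IntegerScrew.closes`. -/
theorem integerScrewAssembly_proof : Summit.RiemannHypothesis.RiemannHypothesis.Theses.IntegerScrew.Assembly :=
  -- buildfix 2026-08-26 (class (i) drift, proof-only): the route's deciding theorem `closes` was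
  -- re-pointed 2026-08-26T09:10Z to the rung `ScrewFloorTrialBound → ScrewFloorLimsupQuarter`, so the
  -- assembly is re-glued from the landed pieces: indicator-vector diagonal extraction of the polynomial
  -- floor (`IntegerScrewSplit.diag_of_screwPolyFloor`, Theorems/IntegerScrewScrewPolyFloorSplit) gives
  -- `0 ≤ Ψ(log m)` for every `m ≥ 1`, and the hypothesis `DiscreteLandau` turns that into RH.
  fun hF hL => hL (Summit.RiemannHypothesis.RiemannHypothesis.Theorems.IntegerScrewSplit.diag_of_screwPolyFloor hF)

end Summit.RiemannHypothesis.RiemannHypothesis.Theorems
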